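import Mathlib
import HarnessLib
import Literature.NumberTheory.Sieve.BatemanHorn
import Summits.Parity.BatemanHorn.Theorems.AlmostPrimeZerosSystemZeroRepulsionFarZoneWideLemmas

/-!
# Far zone of the almost-prime zeros from the wide moment (stub `stub_farZone_of_farMomentWide`)

Line `smooth-rough-lattice-acquisition` of crux stmt-Parity-11291
(`Summit.Parity.BatemanHorn.Theses.AlmostPrimeZeros.SystemZeroRepulsion`), stub S2′ (the
reshaped far zone; it supersedes S2 `stub_farZone_of_farMoment` of
`AlmostPrimeZerosSystemZeroRepulsionFarZone.lean`, whose moment hypothesis S1 was too strong).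

Let `P_x = Σ_{0 ≤ n ≤ x} X^{s_f(n)} ∈ ℂ[X]` be the almost-prime polynomial of a Bateman–Horn
system `f` (so `P_x(z) = Σ_{n ≤ x} z^{s_f(n)}`, `P_x(1) = x + 1`), `L = log log x`, `T = √(log x)`.
GIVEN the wide exponential moment (S1′) `Σ_{n ≤ x} t^{s_f(n)} ≤ (x+1) e^{C₁ (tL + t²/L)}` for
`1 ≤ t ≤ T`, the FAR zone sum `Σ_{ρ : ‖1−ρ‖ ≥ L} ‖1 − ρ‖⁻²` over the roots of `P_x` (with
multiplicity) is bounded for `x ≥ 64`, by `4(1+e)C₁⁺ + 8(1+e)²C₁⁺ + 16e²(4 + 4C₁⁺)`,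
`C₁⁺ = max C₁ 0`.

Proof.  (1) Jensen count (`farW_card_filter_le`, Mathlib's Jensen inequality
`AnalyticOnNhd.sum_divisor_le` on the circles `‖z−1‖ = t` and `‖z−1‖ = et`, the divisor of a
polynomial being its root multiplicity): on `‖z − 1‖ = et` one has `‖z‖ ≤ 1 + et`, so
`‖P_x(z)‖ ≤ Σ_n (1+et)^{s_f(n)} ≤ (x+1) e^{C₁((1+et)L + (1+et)²/L)}` as long as `1 + et ≤ T`, whence
`N(t) := #{ρ : ‖1−ρ‖ ≤ t} ≤ C₁((1+et)L + (1+et)²/L) ≤ (1+e)C₁ L t + (1+e)²C₁ t²/L` (`t ≥ 1`).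
(2) Total count: with `d = max_{n ≤ x} s_f(n) ≥ deg P_x ≥ #roots`, the moment at `t = T` gives
`T^d ≤ (x+1) e^{C₁(TL + T²/L)}`, i.e. `d L/2 ≤ log(x+1) + C₁TL + C₁ log x/L`, so
`#roots ≤ d ≤ (4 + 4C₁) log x`.  (3) The wide dyadic layer-cake `stub_farLayerCakeWide` on the
far multiset with threshold `R = (T−1)/(2e) ≤ T = e^{L/2}` (so that `1 + e L2^{i+1} ≤ T` whenever
`L 2^i < R`): roots beyond `R` are counted trivially (`≤ #roots · R⁻²`, `R⁻² ≤ 16e²/log x`), the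
shells below `R` contribute `≤ 4(1+e)C₁ + 8(1+e)²C₁`.

References: E. C. Titchmarsh, *The Theory of Functions*, 2nd ed., §3.61 (Jensen's formula).
-/

noncomputable section

namespace Summit.Parity.BatemanHorn.Cruxes.SystemZeroRepulsion.SmoothRoughLatticeAcquisition

open Polynomial Set Metric

/-- For a non-zero complex polynomial `P` and `a ∈ ℂ`, the order of vanishing of `z ↦ P(z)` at
`a` is the root multiplicity `mult_a(P)`: write `P = (X - a)^m Q` with `Q(a) ≠ 0`. [folklore] -/
private theorem farW_analyticOrderAt_eval {P : ℂ[X]} (hP : P ≠ 0) (a : ℂ) :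
    analyticOrderAt (fun z => P.eval z) a = P.rootMultiplicity a := by
  -- adapted from
  -- Summits/Parity/BatemanHorn/Theorems/AlmostPrimeZerosSystemZeroRepulsionFarZone.lean
  set m := P.rootMultiplicity a with hm
  set Q := P /ₘ (X - C a) ^ m with hQ
  have hdec : (X - C a) ^ m * Q = P := P.pow_mul_divByMonic_rootMultiplicity_eq a
  have hQa : Q.eval a ≠ 0 := eval_divByMonic_pow_rootMultiplicity_ne_zero a hP
  have hfun : (fun z => P.eval z) = ((· - a) ^ m) * fun z => Q.eval z := by
    funext z
    conv_lhs => rw [← hdec]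
    simp [eval_pow]
  have h1 : AnalyticAt ℂ ((· - a) ^ m) a := by fun_prop
  have h2 : AnalyticAt ℂ (fun z => Q.eval z) a := Q.differentiable.analyticAt a
  rw [hfun, analyticOrderAt_mul h1 h2, analyticOrderAt_centeredMonomial,
    h2.analyticOrderAt_eq_zero.mpr hQa, add_zero]

/-- **Jensen count at the centre `1`.**  If `P ∈ ℂ[z]`, `P(1) ≠ 0`, `t > 0`, `‖P(1)‖ e^M ≥ 1` and
`‖P(z)‖ ≤ ‖P(1)‖ e^M` on the circle `‖z − 1‖ = e t`, then the number of roots of `P` with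
`‖1 − ρ‖ ≤ t`, counted with multiplicity, is at most `M`: Jensen's inequality (Mathlib
`AnalyticOnNhd.sum_divisor_le`, radii `t < et`, `log(et/t) = 1`) bounds the divisor of `z ↦ P(z)`
summed over the closed disc `‖z − 1‖ ≤ t` by `log(‖P(1)‖e^M/‖P(1)‖) = M`, and that divisor is the
root multiplicity. [folklore] -/
private theorem farW_card_filter_le {P : ℂ[X]} (h1 : P.eval 1 ≠ 0) {t M : ℝ} (ht : 0 < t)
    (hM : 1 ≤ ‖P.eval 1‖ * Real.exp M)
    (hb : ∀ z : ℂ, ‖z - 1‖ = Real.exp 1 * t → ‖P.eval z‖ ≤ ‖P.eval 1‖ * Real.exp M) :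
    ((P.roots.filter fun ρ : ℂ => ‖(1 : ℂ) - ρ‖ ≤ t).card : ℝ) ≤ M := by
  -- adapted from
  -- Summits/Parity/BatemanHorn/Theorems/AlmostPrimeZerosSystemZeroRepulsionFarZone.lean
  classical
  have hP : P ≠ 0 := fun h => h1 (by simp [h])
  have he1 : 1 < Real.exp 1 := by linarith [Real.exp_one_gt_d9]
  have hat : |t| = t := abs_of_pos ht
  have haR : |Real.exp 1 * t| = Real.exp 1 * t := abs_of_pos (by positivity)
  have hfan : ∀ r : ℝ, AnalyticOnNhd ℂ (fun z => P.eval z) (closedBall (1 : ℂ) |r|) := fun r =>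
    (AnalyticOnNhd.eval_polynomial P).mono (subset_univ _)
  have hJ : ((∑ᶠ u, MeromorphicOn.divisor (fun z => P.eval z) (closedBall (1 : ℂ) |t|) u : ℤ) : ℝ) ≤
      Real.log (‖P.eval 1‖ * Real.exp M / ‖P.eval 1‖) / Real.log (Real.exp 1 * t / t) :=
    (hfan _).sum_divisor_le (by rwa [hat]) (by rw [hat, haR]; exact lt_mul_left ht he1) hM h1
      fun z hz => hb z (by rwa [mem_sphere, dist_eq_norm, haR] at hz)
  rw [mul_div_cancel_left₀ _ (norm_ne_zero_iff.2 h1), Real.log_exp,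
    mul_div_cancel_right₀ _ ht.ne', Real.log_exp, div_one] at hJ
  -- identify the divisor on the disc `‖z - 1‖ ≤ t` with the root multiplicity
  set D := MeromorphicOn.divisor (fun z => P.eval z) (closedBall (1 : ℂ) |t|) with hD
  have hDin : ∀ u : ℂ, ‖1 - u‖ ≤ t → D u = P.rootMultiplicity u := by
    intro u hu
    have hmem : u ∈ closedBall (1 : ℂ) |t| := by
      rw [mem_closedBall, dist_eq_norm, norm_sub_rev, hat]; exact hu
    rw [hD, MeromorphicOn.AnalyticOnNhd.divisor_apply (hfan t) hmem, farW_analyticOrderAt_eval hP u]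
    simp
  have hsupp : Function.support D ⊆
      ↑(P.roots.toFinset.filter fun ρ : ℂ => ‖(1 : ℂ) - ρ‖ ≤ t) := by
    intro u hu
    rw [Function.mem_support] at hu
    have hin : ‖1 - u‖ ≤ t := by
      by_contra h
      refine hu (Function.locallyFinsuppWithin.apply_eq_zero_of_notMem _ ?_)
      rwa [mem_closedBall, dist_eq_norm, norm_sub_rev, hat]
    rw [hDin u hin] at hu
    have hroot : IsRoot P u :=
      (rootMultiplicity_pos hP).1 (Nat.pos_of_ne_zero (by exact_mod_cast hu))
    simp only [Finset.coe_filter, Set.mem_setOf_eq, Multiset.mem_toFinset, mem_roots hP]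
    exact ⟨hroot, hin⟩
  have hcount : ((P.roots.filter fun ρ : ℂ => ‖(1 : ℂ) - ρ‖ ≤ t).card : ℤ) = ∑ᶠ u, D u := by
    rw [finsum_eq_sum_of_support_subset _ hsupp, ← Multiset.toFinset_sum_count_eq,
      Multiset.toFinset_filter]
    push_cast
    refine Finset.sum_congr rfl fun u hu => ?_
    have hu' := (Finset.mem_filter.1 hu).2
    rw [Multiset.count_filter_of_pos (p := fun ρ : ℂ => ‖(1 : ℂ) - ρ‖ ≤ t) hu', count_roots,
      hDin u hu']
  have h : (((P.roots.filter fun ρ : ℂ => ‖(1 : ℂ) - ρ‖ ≤ t).card : ℤ) : ℝ) ≤ M := by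
    rw [hcount]; exact hJ
  exact_mod_cast h

/-- Numerics for `x ≥ 64`: `log x ≥ 6 log 2 > 4` and `log log x ≥ log 4 > 1` (`4 > e`). -/
private theorem farW_numerics {x : ℝ} (hx : 64 ≤ x) :
    4 ≤ Real.log x ∧ 1 ≤ Real.log (Real.log x) := by
  -- adapted from
  -- Summits/Parity/BatemanHorn/Theorems/AlmostPrimeZerosSystemZeroRepulsionFarZone.lean
  have h64 : Real.log 64 = 6 * Real.log 2 := by
    rw [show (64 : ℝ) = 2 ^ 6 by norm_num, Real.log_pow]
    norm_num
  have h4 : 4 ≤ Real.log x := by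
    have : Real.log 64 ≤ Real.log x := Real.log_le_log (by norm_num) hx
    linarith [Real.log_two_gt_d9]
  refine ⟨h4, ?_⟩
  calc (1 : ℝ) = Real.log (Real.exp 1) := (Real.log_exp 1).symm
    _ ≤ Real.log (Real.log x) :=
        Real.log_le_log (Real.exp_pos 1) (by linarith [Real.exp_one_lt_d9])

/-- The core of the stub over an arbitrary exponent sequence `s : ℕ → ℕ`: for `x ≥ 64` and
`C₁ ≥ 0`, the wide moment bound `Σ_{n ≤ x} t^{s(n)} ≤ (x+1) e^{C₁ (t L + t²/L)}`
(`L = log log x`, `1 ≤ t ≤ √(log x)`) implies that the far sum `Σ_{ρ : ‖1−ρ‖ ≥ L} ‖1−ρ‖⁻²` over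
the roots of `Σ_{n ≤ x} X^{s(n)}` is at most `4(1+e)C₁ + 8(1+e)²C₁ + 16e²(4 + 4C₁)` (Jensen count
on the circles `‖z−1‖ = et`, `1 + et ≤ √(log x)`; total count `≤ (4 + 4C₁) log x` from the moment
at `t = √(log x)`; wide dyadic layer-cake with threshold `R = (√(log x) − 1)/(2e)`). -/
private theorem farW_core {C₁ : ℝ} (hC₁ : 0 ≤ C₁) (s : ℕ → ℕ) {x : ℕ} (hx : 64 ≤ x)
    (hmom : ∀ t : ℝ, 1 ≤ t → t ≤ Real.sqrt (Real.log (x : ℝ)) →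
      ∑ n ∈ Finset.range (x + 1), t ^ (s n) ≤
        ((x : ℝ) + 1) * Real.exp (C₁ * (t * Real.log (Real.log (x : ℝ)) +
          t ^ 2 / Real.log (Real.log (x : ℝ))))) :
    ((((∑ n ∈ Finset.range (x + 1), (X : ℂ[X]) ^ (s n))).roots.filter
        (fun ρ : ℂ => Real.log (Real.log (x : ℝ)) ≤ ‖(1 : ℂ) - ρ‖)).map
      (fun ρ : ℂ => (‖(1 : ℂ) - ρ‖ ^ 2)⁻¹)).sum ≤
      4 * ((1 + Real.exp 1) * C₁) + 8 * ((1 + Real.exp 1) ^ 2 * C₁) +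
        16 * Real.exp 1 ^ 2 * (4 + 4 * C₁) := by
  -- adapted from `far_core` in
  -- Summits/Parity/BatemanHorn/Theorems/AlmostPrimeZerosSystemZeroRepulsionFarZone.lean
  set L : ℝ := Real.log (Real.log (x : ℝ)) with hL
  set T : ℝ := Real.sqrt (Real.log (x : ℝ)) with hT
  set P : ℂ[X] := ∑ n ∈ Finset.range (x + 1), (X : ℂ[X]) ^ (s n) with hP
  -- numerics
  have hx64 : (64 : ℝ) ≤ x := by exact_mod_cast hx
  obtain ⟨hlogx4, hL1⟩ := farW_numerics hx64
  have hL0 : 0 < L := by linarith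
  have hlogx : 0 < Real.log (x : ℝ) := by linarith
  have hT2 : 2 ≤ T := (Real.le_sqrt (by norm_num) hlogx.le).2 (by linarith)
  have hT0 : 0 < T := by linarith
  have hTsq : T ^ 2 = Real.log (x : ℝ) := Real.sq_sqrt hlogx.le
  have hlogT : Real.log T = L / 2 := by rw [hT, Real.log_sqrt hlogx.le]
  -- evaluation facts
  have heval : ∀ z : ℂ, P.eval z = ∑ n ∈ Finset.range (x + 1), z ^ (s n) := fun z => by
    simp [hP, Polynomial.eval_finsetSum]
  have hnorm1 : ‖P.eval 1‖ = (x : ℝ) + 1 := by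
    rw [heval]
    simpa using Complex.norm_natCast (x + 1)
  have hP1ne : P.eval 1 ≠ 0 := norm_pos_iff.mp (by rw [hnorm1]; positivity)
  -- (1) Jensen count on `‖z - 1‖ = et`, `1 ≤ t`, `1 + et ≤ T`:
  -- `N(t) ≤ C₁((1+et)L + (1+et)²/L) ≤ (1+e)C₁ L t + (1+e)²C₁ t²/L`
  have hN : ∀ t : ℝ, 1 ≤ t → 1 + Real.exp 1 * t ≤ T →
      ((P.roots.filter fun ρ : ℂ => ‖(1 : ℂ) - ρ‖ ≤ t).card : ℝ) ≤
        (1 + Real.exp 1) * C₁ * L * t + (1 + Real.exp 1) ^ 2 * C₁ * t ^ 2 / L := by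
    intro t ht htT
    have hM0 : 0 ≤ C₁ * ((1 + Real.exp 1 * t) * L + (1 + Real.exp 1 * t) ^ 2 / L) := by
      positivity
    refine (farW_card_filter_le hP1ne
      (M := C₁ * ((1 + Real.exp 1 * t) * L + (1 + Real.exp 1 * t) ^ 2 / L)) (by linarith)
      (by rw [hnorm1]; exact one_le_mul_of_one_le_of_one_le (by linarith [(Nat.cast_nonneg x :
        (0 : ℝ) ≤ x)]) (Real.one_le_exp hM0)) fun z hz => ?_).trans ?_
    · rw [heval, hnorm1]
      have hz1 : ‖z‖ ≤ 1 + Real.exp 1 * t := by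
        have h := norm_sub_norm_le z 1
        rw [norm_one, hz] at h
        linarith
      calc ‖∑ n ∈ Finset.range (x + 1), z ^ (s n)‖
          ≤ ∑ n ∈ Finset.range (x + 1), ‖z ^ (s n)‖ := norm_sum_le _ _
        _ ≤ ∑ n ∈ Finset.range (x + 1), (1 + Real.exp 1 * t) ^ (s n) :=
            Finset.sum_le_sum fun n _ => by
              rw [norm_pow]
              exact pow_le_pow_left₀ (norm_nonneg _) hz1 _
        _ ≤ ((x : ℝ) + 1) * Real.exp (C₁ * ((1 + Real.exp 1 * t) * L +
              (1 + Real.exp 1 * t) ^ 2 / L)) :=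
            hmom _ (le_add_of_nonneg_right (by positivity)) htT
    · have h : 1 + Real.exp 1 * t ≤ (1 + Real.exp 1) * t := by nlinarith
      have h0 : 0 ≤ 1 + Real.exp 1 * t := by positivity
      have h1 : (1 + Real.exp 1 * t) * L ≤ (1 + Real.exp 1) * t * L :=
        mul_le_mul_of_nonneg_right h hL0.le
      have h2 : (1 + Real.exp 1 * t) ^ 2 / L ≤ ((1 + Real.exp 1) * t) ^ 2 / L :=
        div_le_div_of_nonneg_right (pow_le_pow_left₀ h0 h 2) hL0.le
      calc C₁ * ((1 + Real.exp 1 * t) * L + (1 + Real.exp 1 * t) ^ 2 / L)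
          ≤ C₁ * ((1 + Real.exp 1) * t * L + ((1 + Real.exp 1) * t) ^ 2 / L) :=
            mul_le_mul_of_nonneg_left (add_le_add h1 h2) hC₁
        _ = (1 + Real.exp 1) * C₁ * L * t + (1 + Real.exp 1) ^ 2 * C₁ * t ^ 2 / L := by ring
  -- (2) total count: `#roots ≤ deg P ≤ d = max s ≤ (4 + 4 C₁) log x` from the moment at `t = T`
  have hcardR : (P.roots.card : ℝ) ≤ (4 + 4 * C₁) * Real.log (x : ℝ) := by
    obtain ⟨n₀, hn₀, hdn₀⟩ := Finset.exists_mem_eq_sup (Finset.range (x + 1)) ⟨0, by simp⟩ s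
    set d : ℕ := (Finset.range (x + 1)).sup s with hd
    have hcard : P.roots.card ≤ d := (Polynomial.card_roots' P).trans
      (Polynomial.natDegree_sum_le_of_forall_le _ _ fun n hn => by
        rw [Polynomial.natDegree_X_pow]
        exact Finset.le_sup hn)
    have hTd : T ^ d ≤ ((x : ℝ) + 1) * Real.exp (C₁ * (T * L + T ^ 2 / L)) := by
      rw [hdn₀]
      exact (Finset.single_le_sum (f := fun n => T ^ (s n)) (fun n _ => by positivity) hn₀).trans
        (hmom T (by linarith) le_rfl)
    have hx1 : (0 : ℝ) < (x : ℝ) + 1 := by positivity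
    have hlog : (d : ℝ) * (L / 2) ≤ Real.log ((x : ℝ) + 1) + C₁ * (T * L + T ^ 2 / L) := by
      have h := Real.log_le_log (pow_pos hT0 d) hTd
      rwa [Real.log_pow, hlogT, Real.log_mul hx1.ne' (Real.exp_pos _).ne', Real.log_exp] at h
    have hlogx1 : Real.log ((x : ℝ) + 1) ≤ 2 * Real.log (x : ℝ) := by
      have hx0 : (0 : ℝ) < x := by linarith
      calc Real.log ((x : ℝ) + 1) ≤ Real.log ((x : ℝ) * x) :=
            Real.log_le_log hx1 (by nlinarith)
        _ = 2 * Real.log (x : ℝ) := by rw [Real.log_mul hx0.ne' hx0.ne']; ring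
    have hTle : T ≤ Real.log (x : ℝ) := by
      rw [← hTsq]
      nlinarith
    have hT2L : T ^ 2 / L ≤ Real.log (x : ℝ) := by
      rw [hTsq]
      exact div_le_self hlogx.le hL1
    have hdL : (d : ℝ) * L ≤ (4 + 4 * C₁) * Real.log (x : ℝ) * L := by
      have h1 : Real.log (x : ℝ) ≤ Real.log (x : ℝ) * L := le_mul_of_one_le_right hlogx.le hL1
      have h2 : C₁ * T * L ≤ C₁ * Real.log (x : ℝ) * L :=
        mul_le_mul_of_nonneg_right (mul_le_mul_of_nonneg_left hTle hC₁) hL0.le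
      have h3 : C₁ * (T ^ 2 / L) ≤ C₁ * Real.log (x : ℝ) := mul_le_mul_of_nonneg_left hT2L hC₁
      have h4 : C₁ * Real.log (x : ℝ) ≤ C₁ * Real.log (x : ℝ) * L :=
        le_mul_of_one_le_right (by positivity) hL1
      linarith
    calc (P.roots.card : ℝ) ≤ d := by exact_mod_cast hcard
      _ ≤ _ := le_of_mul_le_mul_right hdL hL0
  -- (3) the wide dyadic layer-cake on the far multiset, threshold `R = (T - 1)/(2e) ≤ T = e^{L/2}`
  set S := P.roots.filter (fun ρ : ℂ => L ≤ ‖(1 : ℂ) - ρ‖) with hS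
  set R : ℝ := (T - 1) / (2 * Real.exp 1) with hR
  have hR0 : 0 < R := div_pos (by linarith) (by positivity)
  have hRT : R ≤ Real.exp (L / 2) := by
    rw [← hlogT, Real.exp_log hT0, hR, div_le_iff₀ (by positivity)]
    nlinarith [Real.exp_one_gt_d9]
  have hcount : ∀ i : ℕ, L * 2 ^ i < R →
      ((S.filter fun ρ : ℂ => ‖(1 : ℂ) - ρ‖ ≤ L * 2 ^ (i + 1)).card : ℝ) ≤
        (1 + Real.exp 1) * C₁ * L * (L * 2 ^ (i + 1)) +
          (1 + Real.exp 1) ^ 2 * C₁ * (L * 2 ^ (i + 1)) ^ 2 / L := by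
    intro i hi
    have ht1 : 1 ≤ L * 2 ^ (i + 1) := one_le_mul_of_one_le_of_one_le hL1 (one_le_pow₀ one_le_two)
    have htT : 1 + Real.exp 1 * (L * 2 ^ (i + 1)) ≤ T := by
      have h3 : Real.exp 1 * (2 * R) = T - 1 := by
        rw [hR]
        field_simp
      rw [pow_succ]
      nlinarith [mul_lt_mul_of_pos_left hi (Real.exp_pos 1)]
    refine le_trans ?_ (hN _ ht1 htT)
    exact_mod_cast Multiset.card_le_card (Multiset.filter_le_filter _ (Multiset.filter_le _ _))
  have hcardS : (S.card : ℝ) ≤ (4 + 4 * C₁) * Real.log (x : ℝ) :=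
    le_trans (by exact_mod_cast Multiset.card_le_card (Multiset.filter_le _ _)) hcardR
  have hmain := stub_farLayerCakeWide S L R _ _ _ hL1 hR0 hRT (by positivity) (by positivity)
    (fun ρ hρ => (Multiset.mem_filter.1 hρ).2) hcount hcardS
  -- `R ≥ T/(4e)`: `R⁻² ≤ 16 e² / log x`, so the trivially counted part is `≤ 16 e² (4 + 4C₁)`
  have hR3 : (R ^ 2)⁻¹ ≤ 16 * Real.exp 1 ^ 2 / Real.log (x : ℝ) := by
    rw [inv_eq_one_div, div_le_div_iff₀ (by positivity) hlogx, ← hTsq, hR, div_pow, one_mul]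
    have h : 16 * Real.exp 1 ^ 2 * ((T - 1) ^ 2 / (2 * Real.exp 1) ^ 2) = 4 * (T - 1) ^ 2 := by
      field_simp
      ring
    rw [h]
    nlinarith
  have hRinv : (4 + 4 * C₁) * Real.log (x : ℝ) * (R ^ 2)⁻¹ ≤
      16 * Real.exp 1 ^ 2 * (4 + 4 * C₁) :=
    calc (4 + 4 * C₁) * Real.log (x : ℝ) * (R ^ 2)⁻¹
        ≤ (4 + 4 * C₁) * Real.log (x : ℝ) * (16 * Real.exp 1 ^ 2 / Real.log (x : ℝ)) :=
          mul_le_mul_of_nonneg_left hR3 (by positivity)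
      _ = 16 * Real.exp 1 ^ 2 * (4 + 4 * C₁) := by field_simp
  linarith [hmain, hRinv]

/-- **S2′ `stub_farZone_of_farMomentWide`** (FAR zone from the wide exponential moment; Jensen at
the centre `1` + wide dyadic layer-cake summation).  If for every Bateman–Horn system `f` the
almost-prime moments satisfy `Σ_{n ≤ x} t^{s_f(n)} ≤ (x+1) e^{C (t log log x + t²/log log x)}`
for `x ≥ 3`, `1 ≤ t ≤ √(log x)`, then for every Bateman–Horn system the far-zone sum
`Σ_{ρ : ‖1−ρ‖ ≥ log log x} ‖1 − ρ‖⁻²` over the roots (with multiplicity) of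
`P_x = Σ_{n ≤ x} X^{s_f(n)}` is bounded for `x ≥ 64`, by `4(1+e)C⁺ + 8(1+e)²C⁺ + 16e²(4 + 4C⁺)`
with `C⁺ = max C 0`.  Proof: on `‖z − 1‖ = et` with `1 + et ≤ √(log x)`,
`‖P_x(z)‖ ≤ Σ_n (1+et)^{s_f(n)} ≤ (x+1)e^{C((1+et)L + (1+et)²/L)}` (`L = log log x`), so Jensen
gives the count `N(t) ≤ (1+e)C L t + (1+e)²C t²/L`; the moment at `t = √(log x)` bounds
`deg P_x`, hence the total count, by `(4+4C) log x`; dyadic shells of ratio `2` from `L` up to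
`(√(log x) − 1)/(2e)` (the quadratic correction costs `4(1+e)²C/L` per shell, over `≤ 2L`
shells) and the trivial bound beyond. -/
theorem stub_farZone_of_farMomentWide :
    (∀ (k : ℕ) (f : Fin k → Polynomial ℤ), Literature.NumberTheory.Sieve.IsBatemanHornSystem f →
      ∃ C : ℝ, ∀ x : ℕ, 3 ≤ x → ∀ t : ℝ, 1 ≤ t → t ≤ Real.sqrt (Real.log (x : ℝ)) →
        (∑ n ∈ Finset.range (x + 1), (t : ℝ) ^ (∑ i, (((f i).eval (n : ℤ)).toNat.factorization.sum fun _ v => min v 2))) ≤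
          ((x : ℝ) + 1) * Real.exp (C * (t * Real.log (Real.log (x : ℝ)) + t ^ 2 / Real.log (Real.log (x : ℝ))))) →
    ∀ (k : ℕ) (f : Fin k → Polynomial ℤ), Literature.NumberTheory.Sieve.IsBatemanHornSystem f →
      ∃ C : ℝ, ∃ x₀ : ℕ, ∀ x : ℕ, x₀ ≤ x →
        ((((∑ n ∈ Finset.range (x + 1), (Polynomial.X : Polynomial ℂ) ^ (∑ i, (((f i).eval (n : ℤ)).toNat.factorization.sum fun _ v => min v 2)))).roots.filter (fun ρ : ℂ => Real.log (Real.log (x : ℝ)) ≤ ‖(1 : ℂ) - ρ‖)).map (fun ρ : ℂ => (‖(1 : ℂ) - ρ‖ ^ 2)⁻¹)).sum ≤ C := by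
  intro hmom k f hf
  obtain ⟨C₁, hC₁⟩ := hmom k f hf
  refine ⟨4 * ((1 + Real.exp 1) * max C₁ 0) + 8 * ((1 + Real.exp 1) ^ 2 * max C₁ 0) +
    16 * Real.exp 1 ^ 2 * (4 + 4 * max C₁ 0), 64, fun x hx => ?_⟩
  have hL1 : 1 ≤ Real.log (Real.log (x : ℝ)) :=
    (farW_numerics (show (64 : ℝ) ≤ x by exact_mod_cast hx)).2
  refine farW_core (le_max_right C₁ 0)
    (fun n => ∑ i, (((f i).eval (n : ℤ)).toNat.factorization.sum fun _ v => min v 2)) hx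
    fun t ht1 htT => (hC₁ x (le_trans (by norm_num) hx) t ht1 htT).trans ?_
  refine mul_le_mul_of_nonneg_left (Real.exp_le_exp.2 ?_) (by positivity)
  have h0 : 0 ≤ t * Real.log (Real.log (x : ℝ)) + t ^ 2 / Real.log (Real.log (x : ℝ)) := by
    positivity
  exact mul_le_mul_of_nonneg_right (le_max_left _ _) h0

/-- **Far zone from the wide moment, PER STATISTIC** (public form of the core of S2′, for the
class-by-class composition of the crux; lead c2, 2026-08-17).  For an arbitrary exponent sequence
`s : ℕ → ℕ`: if `Σ_{n ≤ x} t^{s(n)} ≤ (x+1) e^{C₁ (t log log x + t²/log log x)}` for all `x ≥ x₀`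
(`x ≥ 3`) and `1 ≤ t ≤ √(log x)`, then for every `x ≥ max x₀ 64` the far-zone sum
`Σ_{ρ : ‖1−ρ‖ ≥ log log x} ‖1 − ρ‖⁻²` over the roots (with multiplicity) of `Σ_{n ≤ x} X^{s(n)}` is at
most `4(1+e)C₁⁺ + 8(1+e)²C₁⁺ + 16e²(4 + 4C₁⁺)`, `C₁⁺ = max C₁ 0`.  Unlike
`stub_farZone_of_farMomentWide` this needs the moment for ONE sequence only.  Registered helper stub `stub_farZoneStat`
of the crux (lead c2). -/
theorem stub_farZoneStat :
    ∀ (s : ℕ → ℕ) (C₁ : ℝ) (x₀ : ℕ),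
      (∀ x : ℕ, x₀ ≤ x → 3 ≤ x → ∀ t : ℝ, 1 ≤ t → t ≤ Real.sqrt (Real.log (x : ℝ)) →
        ∑ n ∈ Finset.range (x + 1), t ^ (s n) ≤
          ((x : ℝ) + 1) * Real.exp (C₁ * (t * Real.log (Real.log (x : ℝ)) + t ^ 2 / Real.log (Real.log (x : ℝ))))) →
      ∀ x : ℕ, max x₀ 64 ≤ x →
        ((((∑ n ∈ Finset.range (x + 1), (Polynomial.X : Polynomial ℂ) ^ (s n))).roots.filter
            (fun ρ : ℂ => Real.log (Real.log (x : ℝ)) ≤ ‖(1 : ℂ) - ρ‖)).map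
          (fun ρ : ℂ => (‖(1 : ℂ) - ρ‖ ^ 2)⁻¹)).sum ≤
          4 * ((1 + Real.exp 1) * max C₁ 0) + 8 * ((1 + Real.exp 1) ^ 2 * max C₁ 0) +
            16 * Real.exp 1 ^ 2 * (4 + 4 * max C₁ 0) := by
  intro s C₁ x₀ hmom x hx
  have hx64 : 64 ≤ x := le_of_max_le_right hx
  have hL1 : 1 ≤ Real.log (Real.log (x : ℝ)) :=
    (farW_numerics (show (64 : ℝ) ≤ x by exact_mod_cast hx64)).2
  refine farW_core (le_max_right C₁ 0) s hx64
    fun t ht1 htT => (hmom x (le_of_max_le_left hx) (le_trans (by norm_num) hx64) t ht1 htT).trans ?_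
  refine mul_le_mul_of_nonneg_left (Real.exp_le_exp.2 ?_) (by positivity)
  have h0 : 0 ≤ t * Real.log (Real.log (x : ℝ)) + t ^ 2 / Real.log (Real.log (x : ℝ)) := by
    positivity
  exact mul_le_mul_of_nonneg_right (le_max_left _ _) h0

end Summit.Parity.BatemanHorn.Cruxes.SystemZeroRepulsion.SmoothRoughLatticeAcquisition

end
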